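import Mathlib

/-!
# SEIL-F outer end: the WKB–Kelvin hierarchy of the bulk parametrix to second order
(solo-blind s87, kernel #199; PLAN §109 (h), (i))

The bulk parametrix of architecture A‴ for the streak datum `½ e^{±imθ}` is `S = ½ exp Φ` with
`Φ = Φ₀ + K₀ Φ₁ + K₀² Φ₂` built along the Kelvin clock `B(ℓ) = 2P∫h`, `I_B = ∫B`, `I₂ = ∫B²`,
`J_B = ∫I_B`, `J₂ = ∫I₂`, `J_{BB} = ∫B I_B`, `J_{B2} = ∫B I₂` (all from the injection time):

* `Φ₀ = i s m θ + i B cos θ` (`s = ±1`),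
* `Φ₁ = -i I_B cos θ - I₂ sin²θ + 2 s m I_B sin θ - m² ℓ` — i.e. the Orr kill `-∫(B sin θ - s m)²`,
* `Φ₂ = i(1+4m²) J_B cos θ - 2 J₂ (cos²θ - sin²θ) - 4 s m J_B sin θ + 2 J_{BB} sin²θ
        + 4 i J_{B2} sin²θ cos θ - 4 i s m (J_{BB} + J₂) sin θ cos θ`.

The exact phase would solve `Φ_ℓ = 2iPh cos θ + K₀(Φ_θθ + Φ_θ²)`.  This file certifies:
(i) the closed-form first and second `θ`-derivatives of `Φ₀, Φ₁, Φ₂`; (ii) the HIERARCHY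
`∂_ℓΦ₀ = 2iPh cos θ`, `∂_ℓΦ₁ = Φ₀θθ + Φ₀θ²`, `∂_ℓΦ₂ = Φ₁θθ + 2Φ₀θΦ₁θ`; (iii) hence the RESIDUAL
IDENTITY `Φ_ℓ - 2iPh cos θ - K₀(Φ_θθ + Φ_θ²) = -K₀³(Φ₂θθ + Φ₁θ² + 2Φ₀θΦ₂θ) - 2K₀⁴ Φ₁θΦ₂θ - K₀⁵ Φ₂θ²`:
the second-order parametrix has an `O(K₀³)` residual with explicit coefficient (expansion parameter
`1/B* = (K₀/2P|h|)^{1/3}` at the kill time; numerically ε̄ ≈ .07 vs .3 at first order, P|h| = 80).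
-/

namespace Summit.AnomalousDissipation.AnomalousDissipation.Theorems

open Complex

/-! ### The three phase functions and their closed-form `θ`-derivatives -/

/-- `Φ₀ = i s m θ + i B cos θ`. -/
noncomputable def wkbΦ0 (B m s θ : ℂ) : ℂ := I * s * m * θ + I * B * cos θ
/-- `∂_θ Φ₀`. -/
noncomputable def wkbΦ0θ (B m s θ : ℂ) : ℂ := I * s * m - I * B * sin θ
/-- `∂²_θ Φ₀`. -/
noncomputable def wkbΦ0θθ (B θ : ℂ) : ℂ := -(I * B * cos θ)

/-- `Φ₁ = -i I_B cos θ - I₂ sin²θ + 2 s m I_B sin θ - m² ℓ`. -/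
noncomputable def wkbΦ1 (IB I2 l m s θ : ℂ) : ℂ :=
  -(I * IB * cos θ) - I2 * sin θ ^ 2 + 2 * s * m * IB * sin θ - m ^ 2 * l
/-- `∂_θ Φ₁`. -/
noncomputable def wkbΦ1θ (IB I2 m s θ : ℂ) : ℂ :=
  I * IB * sin θ - 2 * I2 * sin θ * cos θ + 2 * s * m * IB * cos θ
/-- `∂²_θ Φ₁`. -/
noncomputable def wkbΦ1θθ (IB I2 m s θ : ℂ) : ℂ :=
  I * IB * cos θ - 2 * I2 * (cos θ ^ 2 - sin θ ^ 2) - 2 * s * m * IB * sin θ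

/-- `Φ₂` (six terms). -/
noncomputable def wkbΦ2 (JB J2 JBB JB2 m s θ : ℂ) : ℂ :=
  I * (1 + 4 * m ^ 2) * JB * cos θ - 2 * J2 * (cos θ ^ 2 - sin θ ^ 2) - 4 * s * m * JB * sin θ
    + 2 * JBB * sin θ ^ 2 + 4 * I * JB2 * sin θ ^ 2 * cos θ - 4 * I * s * m * (JBB + J2) * sin θ * cos θ
/-- `∂_θ Φ₂`. -/
noncomputable def wkbΦ2θ (JB J2 JBB JB2 m s θ : ℂ) : ℂ :=
  -(I * (1 + 4 * m ^ 2) * JB * sin θ) + 8 * J2 * sin θ * cos θ - 4 * s * m * JB * cos θ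
    + 4 * JBB * sin θ * cos θ + 4 * I * JB2 * (2 * sin θ * cos θ ^ 2 - sin θ ^ 3)
    - 4 * I * s * m * (JBB + J2) * (cos θ ^ 2 - sin θ ^ 2)
/-- `∂²_θ Φ₂`. -/
noncomputable def wkbΦ2θθ (JB J2 JBB JB2 m s θ : ℂ) : ℂ :=
  -(I * (1 + 4 * m ^ 2) * JB * cos θ) + 8 * J2 * (cos θ ^ 2 - sin θ ^ 2) + 4 * s * m * JB * sin θ
    + 4 * JBB * (cos θ ^ 2 - sin θ ^ 2) + 4 * I * JB2 * (2 * cos θ ^ 3 - 7 * sin θ ^ 2 * cos θ)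
    + 16 * I * s * m * (JBB + J2) * sin θ * cos θ

/-! Elementary derivative facts over `ℂ` (helper lemmas). -/

/-- Derivative of `sin` over `ℂ`. -/
theorem hd_sin (θ : ℂ) : HasDerivAt (fun x => sin x) (cos θ) θ := Complex.hasDerivAt_sin θ
/-- Derivative of `cos` over `ℂ`. -/
theorem hd_cos (θ : ℂ) : HasDerivAt (fun x => cos x) (-sin θ) θ := Complex.hasDerivAt_cos θ
/-- Derivative of `sin²`. -/
theorem hd_sin2 (θ : ℂ) : HasDerivAt (fun x => sin x ^ 2) (2 * sin θ * cos θ) θ := by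
  have h := (hd_sin θ).pow 2
  exact h.congr_deriv (by ring)
/-- Derivative of `cos²`. -/
theorem hd_cos2 (θ : ℂ) : HasDerivAt (fun x => cos x ^ 2) (-(2 * sin θ * cos θ)) θ := by
  have h := (hd_cos θ).pow 2
  exact h.congr_deriv (by ring)
/-- Derivative of `sin·cos`. -/
theorem hd_sincos (θ : ℂ) : HasDerivAt (fun x => sin x * cos x) (cos θ ^ 2 - sin θ ^ 2) θ := by
  have h := (hd_sin θ).mul (hd_cos θ)
  exact h.congr_deriv (by ring)
/-- Derivative of `sin²·cos`. -/
theorem hd_sin2cos (θ : ℂ) :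
    HasDerivAt (fun x => sin x ^ 2 * cos x) (2 * sin θ * cos θ ^ 2 - sin θ ^ 3) θ := by
  have h := (hd_sin2 θ).mul (hd_cos θ)
  exact h.congr_deriv (by ring)
/-- Derivative of `cos² - sin²`. -/
theorem hd_c2s2 (θ : ℂ) :
    HasDerivAt (fun x => cos x ^ 2 - sin x ^ 2) (-(4 * sin θ * cos θ)) θ := by
  have h := (hd_cos2 θ).sub (hd_sin2 θ)
  exact h.congr_deriv (by ring)
/-- Derivative of `cos³`. -/
theorem hd_cos3 (θ : ℂ) : HasDerivAt (fun x => cos x ^ 3) (-(3 * sin θ * cos θ ^ 2)) θ := by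
  have h := (hd_cos θ).pow 3
  exact h.congr_deriv (by ring)
/-- Derivative of `sin³`. -/
theorem hd_sin3 (θ : ℂ) : HasDerivAt (fun x => sin x ^ 3) (3 * sin θ ^ 2 * cos θ) θ := by
  have h := (hd_sin θ).pow 3
  exact h.congr_deriv (by ring)

/-- `wkbΦ0θ` is the `θ`-derivative of `wkbΦ0`. -/
theorem wkbΦ0_hasDerivAt (B m s θ : ℂ) :
    HasDerivAt (fun x => wkbΦ0 B m s x) (wkbΦ0θ B m s θ) θ := by
  unfold wkbΦ0 wkbΦ0θ
  have h1 : HasDerivAt (fun x : ℂ => I * s * m * x) (I * s * m) θ := by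
    simpa using (hasDerivAt_id θ).const_mul (I * s * m)
  have h := h1.add ((hd_cos θ).const_mul (I * B))
  exact h.congr_deriv (by ring)

/-- `wkbΦ0θθ` is the `θ`-derivative of `wkbΦ0θ`. -/
theorem wkbΦ0θ_hasDerivAt (B m s θ : ℂ) :
    HasDerivAt (fun x => wkbΦ0θ B m s x) (wkbΦ0θθ B θ) θ := by
  unfold wkbΦ0θ wkbΦ0θθ
  have h := ((hd_sin θ).const_mul (I * B)).const_sub (I * s * m)
  exact h.congr_deriv (by ring)

/-- `wkbΦ1θ` is the `θ`-derivative of `wkbΦ1`. -/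
theorem wkbΦ1_hasDerivAt (IB I2 l m s θ : ℂ) :
    HasDerivAt (fun x => wkbΦ1 IB I2 l m s x) (wkbΦ1θ IB I2 m s θ) θ := by
  unfold wkbΦ1 wkbΦ1θ
  have h := ((((hd_cos θ).const_mul (I * IB)).neg.sub ((hd_sin2 θ).const_mul I2)).add
    ((hd_sin θ).const_mul (2 * s * m * IB))).sub_const (m ^ 2 * l)
  exact h.congr_deriv (by ring)

/-- `wkbΦ1θθ` is the `θ`-derivative of `wkbΦ1θ`. -/
theorem wkbΦ1θ_hasDerivAt (IB I2 m s θ : ℂ) :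
    HasDerivAt (fun x => wkbΦ1θ IB I2 m s x) (wkbΦ1θθ IB I2 m s θ) θ := by
  unfold wkbΦ1θ wkbΦ1θθ
  have h := (((hd_sin θ).const_mul (I * IB)).sub ((hd_sincos θ).const_mul (2 * I2))).add
    ((hd_cos θ).const_mul (2 * s * m * IB))
  have h' : HasDerivAt (fun x => I * IB * sin x - 2 * I2 * sin x * cos x + 2 * s * m * IB * cos x)
      (I * IB * cos θ - 2 * I2 * (cos θ ^ 2 - sin θ ^ 2) + 2 * s * m * IB * -sin θ) θ := by
    have hf : (fun x => I * IB * sin x - 2 * I2 * sin x * cos x + 2 * s * m * IB * cos x)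
        = fun x => I * IB * sin x - 2 * I2 * (sin x * cos x) + 2 * s * m * IB * cos x := by
      funext x; ring
    rw [hf]; exact h
  exact h'.congr_deriv (by ring)

/-- `wkbΦ2θ` is the `θ`-derivative of `wkbΦ2`. -/
theorem wkbΦ2_hasDerivAt (JB J2 JBB JB2 m s θ : ℂ) :
    HasDerivAt (fun x => wkbΦ2 JB J2 JBB JB2 m s x) (wkbΦ2θ JB J2 JBB JB2 m s θ) θ := by
  unfold wkbΦ2 wkbΦ2θ
  have h := ((((((hd_cos θ).const_mul (I * (1 + 4 * m ^ 2) * JB)).sub ((hd_c2s2 θ).const_mul (2 * J2))).sub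
    ((hd_sin θ).const_mul (4 * s * m * JB))).add ((hd_sin2 θ).const_mul (2 * JBB))).add
    ((hd_sin2cos θ).const_mul (4 * I * JB2))).sub ((hd_sincos θ).const_mul (4 * I * s * m * (JBB + J2)))
  have hf : (fun x => I * (1 + 4 * m ^ 2) * JB * cos x - 2 * J2 * (cos x ^ 2 - sin x ^ 2) - 4 * s * m * JB * sin x
      + 2 * JBB * sin x ^ 2 + 4 * I * JB2 * sin x ^ 2 * cos x - 4 * I * s * m * (JBB + J2) * sin x * cos x)
      = fun x => I * (1 + 4 * m ^ 2) * JB * cos x - 2 * J2 * (cos x ^ 2 - sin x ^ 2) - 4 * s * m * JB * sin x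
      + 2 * JBB * sin x ^ 2 + 4 * I * JB2 * (sin x ^ 2 * cos x) - 4 * I * s * m * (JBB + J2) * (sin x * cos x) := by
    funext x; ring
  rw [hf]
  exact h.congr_deriv (by ring)

/-- `wkbΦ2θθ` is the `θ`-derivative of `wkbΦ2θ`. -/
theorem wkbΦ2θ_hasDerivAt (JB J2 JBB JB2 m s θ : ℂ) :
    HasDerivAt (fun x => wkbΦ2θ JB J2 JBB JB2 m s x) (wkbΦ2θθ JB J2 JBB JB2 m s θ) θ := by
  unfold wkbΦ2θ wkbΦ2θθ
  have hA : HasDerivAt (fun x => 2 * sin x * cos x ^ 2 - sin x ^ 3)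
      (2 * (cos θ * cos θ ^ 2 + sin θ * -(2 * sin θ * cos θ)) - 3 * sin θ ^ 2 * cos θ) θ := by
    have h := (((hd_sin θ).mul (hd_cos2 θ)).const_mul 2).sub (hd_sin3 θ)
    have hf : (fun x => 2 * sin x * cos x ^ 2 - sin x ^ 3) = fun x => 2 * (sin x * cos x ^ 2) - sin x ^ 3 := by
      funext x; ring
    rw [hf]; exact h.congr_deriv (by ring)
  have h := ((((((hd_sin θ).const_mul (I * (1 + 4 * m ^ 2) * JB)).neg.add ((hd_sincos θ).const_mul (8 * J2))).sub
    ((hd_cos θ).const_mul (4 * s * m * JB))).add ((hd_sincos θ).const_mul (4 * JBB))).add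
    (hA.const_mul (4 * I * JB2))).sub ((hd_c2s2 θ).const_mul (4 * I * s * m * (JBB + J2)))
  have hf : (fun x => -(I * (1 + 4 * m ^ 2) * JB * sin x) + 8 * J2 * sin x * cos x - 4 * s * m * JB * cos x
      + 4 * JBB * sin x * cos x + 4 * I * JB2 * (2 * sin x * cos x ^ 2 - sin x ^ 3)
      - 4 * I * s * m * (JBB + J2) * (cos x ^ 2 - sin x ^ 2))
      = fun x => -(I * (1 + 4 * m ^ 2) * JB * sin x) + 8 * J2 * (sin x * cos x) - 4 * s * m * JB * cos x
      + 4 * JBB * (sin x * cos x) + 4 * I * JB2 * (2 * sin x * cos x ^ 2 - sin x ^ 3)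
      - 4 * I * s * m * (JBB + J2) * (cos x ^ 2 - sin x ^ 2) := by
    funext x; ring
  rw [hf]
  exact h.congr_deriv (by ring)

/-! ### The hierarchy along the clock (ℓ-derivatives, θ fixed) -/

/-- Order 0: `∂_ℓ Φ₀ = 2iPh cos θ` when `B' = 2Ph`. -/
theorem wkb_hierarchy0 {B : ℝ → ℂ} {l : ℝ} (P h m s θ : ℂ) (hB : HasDerivAt B (2 * P * h) l) :
    HasDerivAt (fun x => wkbΦ0 (B x) m s θ) (2 * I * P * h * cos θ) l := by
  unfold wkbΦ0
  have h := ((hB.const_mul I).mul_const (cos θ)).const_add (I * s * m * θ)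
  exact h.congr_deriv (by ring)

/-- Order 1: `∂_ℓ Φ₁ = Φ₀θθ + Φ₀θ²` when `I_B' = B`, `I₂' = B²`, `s² = 1` (the Orr kill is generated
by the square of the total phase gradient). -/
theorem wkb_hierarchy1 {B IB I2 : ℝ → ℂ} {l : ℝ} (m s θ : ℂ) (hs : s ^ 2 = 1)
    (hIB : HasDerivAt IB (B l) l) (hI2 : HasDerivAt I2 (B l ^ 2) l) :
    HasDerivAt (fun x => wkbΦ1 (IB x) (I2 x) (x : ℂ) m s θ)
      (wkbΦ0θθ (B l) θ + wkbΦ0θ (B l) m s θ ^ 2) l := by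
  unfold wkbΦ1 wkbΦ0θθ wkbΦ0θ
  have hl : HasDerivAt (fun x : ℝ => (x : ℂ)) 1 l := by
    simpa using (hasDerivAt_id (l : ℂ)).comp_ofReal
  have h := ((((hIB.const_mul I).mul_const (cos θ)).neg.sub (hI2.mul_const (sin θ ^ 2))).add
    ((hIB.const_mul (2 * s * m)).mul_const (sin θ))).sub (hl.const_mul (m ^ 2))
  refine h.congr_deriv ?_
  linear_combination (-(s * m - B l * sin θ) ^ 2) * Complex.I_sq + m ^ 2 * hs

/-- Order 2: `∂_ℓ Φ₂ = Φ₁θθ + 2 Φ₀θ Φ₁θ` when `J_B' = I_B`, `J₂' = I₂`, `J_{BB}' = B I_B`,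
`J_{B2}' = B I₂`, `s² = 1`. -/
theorem wkb_hierarchy2 {B IB I2 JB J2 JBB JB2 : ℝ → ℂ} {l : ℝ} (m s θ : ℂ) (hs : s ^ 2 = 1)
    (hJB : HasDerivAt JB (IB l) l) (hJ2 : HasDerivAt J2 (I2 l) l)
    (hJBB : HasDerivAt JBB (B l * IB l) l) (hJB2 : HasDerivAt JB2 (B l * I2 l) l) :
    HasDerivAt (fun x => wkbΦ2 (JB x) (J2 x) (JBB x) (JB2 x) m s θ)
      (wkbΦ1θθ (IB l) (I2 l) m s θ + 2 * wkbΦ0θ (B l) m s θ * wkbΦ1θ (IB l) (I2 l) m s θ) l := by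
  unfold wkbΦ2 wkbΦ1θθ wkbΦ0θ wkbΦ1θ
  have h := ((((((hJB.const_mul (I * (1 + 4 * m ^ 2))).mul_const (cos θ)).sub
    ((hJ2.const_mul 2).mul_const (cos θ ^ 2 - sin θ ^ 2))).sub ((hJB.const_mul (4 * s * m)).mul_const (sin θ))).add
    ((hJBB.const_mul 2).mul_const (sin θ ^ 2))).add ((hJB2.const_mul (4 * I)).mul_const (sin θ ^ 2 * cos θ))).sub
    (((hJBB.add hJ2).const_mul (4 * I * s * m)).mul_const (sin θ * cos θ))
  have hf : (fun x => I * (1 + 4 * m ^ 2) * JB x * cos θ - 2 * J2 x * (cos θ ^ 2 - sin θ ^ 2) - 4 * s * m * JB x * sin θ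
      + 2 * JBB x * sin θ ^ 2 + 4 * I * JB2 x * sin θ ^ 2 * cos θ - 4 * I * s * m * (JBB x + J2 x) * sin θ * cos θ)
      = fun x => I * (1 + 4 * m ^ 2) * JB x * cos θ - 2 * J2 x * (cos θ ^ 2 - sin θ ^ 2) - 4 * s * m * JB x * sin θ
      + 2 * JBB x * sin θ ^ 2 + 4 * I * JB2 x * (sin θ ^ 2 * cos θ) - 4 * I * s * m * (JBB x + J2 x) * (sin θ * cos θ) := by
    funext x; ring
  rw [hf]
  refine h.congr_deriv ?_
  linear_combination (2 * B l * IB l * sin θ ^ 2 - 2 * s * m * IB l * sin θ) * Complex.I_sq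
    + (-(4 * I * m ^ 2 * IB l * cos θ)) * hs

/-! ### The residual identity of the second-order parametrix -/

/-- RESIDUAL IDENTITY.  With `Φ = Φ₀ + K₀Φ₁ + K₀²Φ₂` along the clock (hypotheses as in the three
hierarchy lemmas), the ℓ-derivative of `Φ` equals
`2iPh cos θ + K₀(Φ_θθ + Φ_θ²) - K₀³(Φ₂θθ + Φ₁θ² + 2Φ₀θΦ₂θ) - 2K₀⁴ Φ₁θ Φ₂θ - K₀⁵ Φ₂θ²`,
where `Φ_θ = Φ₀θ + K₀Φ₁θ + K₀²Φ₂θ`, `Φ_θθ = Φ₀θθ + K₀Φ₁θθ + K₀²Φ₂θθ` are the certified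
`θ`-derivatives: the residual of `Φ_ℓ = 2iPh cos θ + K₀(Φ_θθ + Φ_θ²)` is `O(K₀³)` with an explicit
coefficient. -/
theorem wkb_residual_order2 {B IB I2 JB J2 JBB JB2 : ℝ → ℂ} {l : ℝ} (K₀ P h m s θ : ℂ) (hs : s ^ 2 = 1)
    (hB : HasDerivAt B (2 * P * h) l) (hIB : HasDerivAt IB (B l) l) (hI2 : HasDerivAt I2 (B l ^ 2) l)
    (hJB : HasDerivAt JB (IB l) l) (hJ2 : HasDerivAt J2 (I2 l) l)
    (hJBB : HasDerivAt JBB (B l * IB l) l) (hJB2 : HasDerivAt JB2 (B l * I2 l) l) :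
    HasDerivAt (fun x => wkbΦ0 (B x) m s θ + K₀ * wkbΦ1 (IB x) (I2 x) (x : ℂ) m s θ
        + K₀ ^ 2 * wkbΦ2 (JB x) (J2 x) (JBB x) (JB2 x) m s θ)
      (2 * I * P * h * cos θ
        + K₀ * ((wkbΦ0θθ (B l) θ + K₀ * wkbΦ1θθ (IB l) (I2 l) m s θ + K₀ ^ 2 * wkbΦ2θθ (JB l) (J2 l) (JBB l) (JB2 l) m s θ)
              + (wkbΦ0θ (B l) m s θ + K₀ * wkbΦ1θ (IB l) (I2 l) m s θ + K₀ ^ 2 * wkbΦ2θ (JB l) (J2 l) (JBB l) (JB2 l) m s θ) ^ 2)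
        - K₀ ^ 3 * (wkbΦ2θθ (JB l) (J2 l) (JBB l) (JB2 l) m s θ + wkbΦ1θ (IB l) (I2 l) m s θ ^ 2
              + 2 * wkbΦ0θ (B l) m s θ * wkbΦ2θ (JB l) (J2 l) (JBB l) (JB2 l) m s θ)
        - 2 * K₀ ^ 4 * (wkbΦ1θ (IB l) (I2 l) m s θ * wkbΦ2θ (JB l) (J2 l) (JBB l) (JB2 l) m s θ)
        - K₀ ^ 5 * wkbΦ2θ (JB l) (J2 l) (JBB l) (JB2 l) m s θ ^ 2) l := by
  have h0 := wkb_hierarchy0 P h m s θ hB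
  have h1 := wkb_hierarchy1 m s θ hs hIB hI2
  have h2 := wkb_hierarchy2 m s θ hs hJB hJ2 hJBB hJB2
  have h := (h0.add (h1.const_mul K₀)).add (h2.const_mul (K₀ ^ 2))
  exact h.congr_deriv (by ring)

/-- In particular the `O(1)`, `O(K₀)` and `O(K₀²)` parts of the residual vanish identically:
the second-order parametrix's residual, as a polynomial in `K₀`, has no terms below `K₀³`. -/
theorem wkb_residual_lowOrders_vanish (Φ0θ Φ0θθ Φ1θ Φ1θθ Φ2θ Φ2θθ Φ0l Φ1l Φ2l D K₀ : ℂ)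
    (h0 : Φ0l = D) (h1 : Φ1l = Φ0θθ + Φ0θ ^ 2) (h2 : Φ2l = Φ1θθ + 2 * Φ0θ * Φ1θ) :
    (Φ0l + K₀ * Φ1l + K₀ ^ 2 * Φ2l)
      - (D + K₀ * ((Φ0θθ + K₀ * Φ1θθ + K₀ ^ 2 * Φ2θθ) + (Φ0θ + K₀ * Φ1θ + K₀ ^ 2 * Φ2θ) ^ 2))
      = -(K₀ ^ 3 * (Φ2θθ + Φ1θ ^ 2 + 2 * Φ0θ * Φ2θ)) - 2 * K₀ ^ 4 * (Φ1θ * Φ2θ) - K₀ ^ 5 * Φ2θ ^ 2 := by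
  rw [h0, h1, h2]; ring

end Summit.AnomalousDissipation.AnomalousDissipation.Theorems
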